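import Mathlib.Data.Fin.Tuple.Basic
import Literature.InformationTheory.Entropy.MapEntropy
import HarnessLib

/-!
# Entropy of images of uniform distributions: equal kernels, and the `t`-fold product rule

Topic `Literature/InformationTheory/Entropy`.  Two elementary ("folklore") rules for the Shannon
entropy `mapEntropy S f = H(f(U_S))` (bits) of
`Literature/InformationTheory/Entropy/MapEntropy.lean`, isolated here because they are used by
the source-polarization chain rule
(`Literature/InformationTheory/Coding/SourcePolarizationChainRule.lean`) and are of independent use:

* `mapEntropy_eq_of_ker_eq` — `H(f(U_S))` only depends on the KERNEL of `f` on `S` (the partition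
  of `S` into fibres): if `f a = f b ↔ f' a = f' b` for all `a, b ∈ S` then
  `H(f(U_S)) = H(f'(U_S))`.  This subsumes invariance under recodings injective on the outputs
  (`mapEntropy_comp_of_injOn`) and spares the construction of the recoding map;
  `mapEntropy_univ_eq_of_ker_eq` is the `Fintype` form.
* `mapEntropy_pi` — the PRODUCT RULE for independent copies: for `f : α → β` on a nonempty finite
  type and `t : ℕ`, the coordinatewise image `X ↦ (f (X c))_{c < t}` of the uniform distribution on
  `Fin t → α` has entropy `t · H(f(U_α))` [Cover–Thomas, Thm 2.6.6 (equality for independent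
  variables); Dvir–Gutfreund–Rothblum–Vadhan 2010, §3 p. 6, "`H(Pᵗ) = t · H(P)`"].  Proof by
  induction on `t` along `Fin (t+1) → α ≃ α × (Fin t → α)` (`Fin.consEquiv`) and additivity on
  independent pairs (`mapEntropy_product`).

The cryptography library carries the same two rules for its (definitionally equal) copy
`Literature.Computability.Cryptography.mapEntropy` (`HILLGenerator.lean: mapEntropy_eq_of_ker_eq`,
`EntropyFlattening.lean: mapEntropy_tuple`); this file is their Mathlib-only home for
`Literature.InformationTheory.Entropy.mapEntropy` (no cryptographic imports).

Not here: conditional entropies and the chain rule for dependent coordinates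
(`MapEntropyChainRule.lean`, `MapEntropySubadditivity.lean`).

## References

* T. M. Cover, J. A. Thomas, *Elements of Information Theory*, 2nd ed., Wiley 2006, Thm 2.6.6,
  Problem 2.4.
* Z. Dvir, D. Gutfreund, G. N. Rothblum, S. Vadhan, *On approximating the entropy of polynomial
  mappings*, ECCC TR10-160 / ICS 2011, §3 p. 6.
-/

namespace Literature.InformationTheory.Entropy

open Finset

variable {ι β β' : Type*} [DecidableEq β] [DecidableEq β']

/-- **Entropy only depends on the kernel.**  If two maps `f`, `f'` induce the same equivalence
relation on `S` (`f a = f b ↔ f' a = f' b` for all `a, b ∈ S`), then `H(f(U_S)) = H(f'(U_S))`: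
the fibres of `f` and of `f'` through every point of `S` coincide, so the defining sums agree
term by term. [folklore] -/
theorem mapEntropy_eq_of_ker_eq {S : Finset ι} {f : ι → β} {f' : ι → β'}
    (h : ∀ a ∈ S, ∀ b ∈ S, (f a = f b ↔ f' a = f' b)) :
    mapEntropy S f = mapEntropy S f' := by
  unfold mapEntropy
  congr 1
  refine Finset.sum_congr rfl fun v hv => ?_
  have hfib : fiber S f (f v) = fiber S f' (f' v) := by
    ext w
    simp only [mem_fiber]
    exact ⟨fun hw => ⟨hw.1, (h w hw.1 v hv).1 hw.2⟩, fun hw => ⟨hw.1, (h w hw.1 v hv).2 hw.2⟩⟩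
  rw [hfib]

/-- **Entropy only depends on the kernel** (`Fintype` form): if `f a = f b ↔ f' a = f' b` for all
`a, b`, then `H(f(U)) = H(f'(U))` for the uniform distribution `U` on the type. [folklore] -/
theorem mapEntropy_univ_eq_of_ker_eq [Fintype ι] {f : ι → β} {f' : ι → β'}
    (h : ∀ a b, (f a = f b ↔ f' a = f' b)) :
    mapEntropy univ f = mapEntropy univ f' :=
  mapEntropy_eq_of_ker_eq fun a _ b _ => h a b

/-- **Product rule for independent copies**: for `f : α → β` on a nonempty finite type `α` and
`t : ℕ`, the coordinatewise image `X ↦ (f (X c))_{c < t}` of the uniform distribution on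
`Fin t → α` — i.e. `t` independent copies of `f(U_α)` — has entropy `t · H(f(U_α))`
(`H(Pᵗ) = t · H(P)`).  Induction on `t`: split off coordinate `0` along
`α × (Fin t → α) ≃ (Fin (t+1) → α)` (`Fin.consEquiv`), identify kernels, and use additivity on
independent pairs (`mapEntropy_product`). [folklore] -/
theorem mapEntropy_pi {α : Type*} [Fintype α] [Nonempty α] (f : α → β) (t : ℕ) :
    mapEntropy univ (fun X : Fin t → α => fun c => f (X c)) = t * mapEntropy univ f := by
  induction t with
  | zero =>
    rw [mapEntropy_of_injective _ (Function.injective_of_subsingleton _)]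
    simp
  | succ t ih =>
    rw [← mapEntropy_univ_comp_equiv (Fin.consEquiv fun _ => α)
      (fun X : Fin (t + 1) → α => fun c => f (X c))]
    have hker : mapEntropy univ ((fun X : Fin (t + 1) → α => fun c => f (X c)) ∘
        (Fin.consEquiv fun _ => α)) =
        mapEntropy univ (Prod.map f fun X : Fin t → α => fun c => f (X c)) := by
      refine mapEntropy_univ_eq_of_ker_eq fun a b => ?_
      have hc : ∀ p : α × (Fin t → α), ((fun X : Fin (t + 1) → α => fun c => f (X c)) ∘
          (Fin.consEquiv fun _ => α)) p = Fin.cons (f p.1) (f ∘ p.2) := fun p =>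
        Fin.comp_cons f p.1 p.2
      rw [hc, hc, Fin.cons_inj]
      simp [Prod.ext_iff, funext_iff]
    rw [hker, ← Finset.univ_product_univ, mapEntropy_product univ_nonempty univ_nonempty, ih]
    push_cast
    ring

end Literature.InformationTheory.Entropy
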